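import Summits.ValiantsHypothesis.ValiantsHypothesis.Theorems.SymPencilPerFourCoordinateRadical
import Summits.ValiantsHypothesis.ValiantsHypothesis.Theorems.SymPencilBoxFourEquality

/-!
# Route `SymPencil` — `H106` is SHARP in the number of squares: a `6`-dimensional singular
# subspace of `per_4` WITH a joint family of SIX squares (`--supports` stmt-ValiantsHypothesis-5674
# `SdcSuperquadratic`; negative calibration for the size-`27` table, cell `(10, 6, 6)`)

`SymPencilPerFourSixDimNoJointFamily.noJointFamily_six` (val-width-5674-p3 g2) says: over a field of
characteristic `0`, no `6`-dimensional `V ⊆ Sing Z(per_4)` (all `3 × 3` subpermanents vanish on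
`V`) carries a joint bilinear family of `d < 6` squares as the `s²`-coefficients of
`per_4 (u + s y)` (`u` arbitrary, `y ∈ V`) — the input `H106₅` of the rung `27 ≤ sdc(per₄)`
(`SymPencilSdcPerFourWindowTwentySeven`).  At size `m = 27` the same cell of the kernel-package
table is `(r, dim V, d) = (10, 6, 6)`, i.e. SIX squares.  This file shows that the bound `d < 6`
is sharp, so that cell is NOT closed by any statement about the subspace `V` alone:

**Theorem** (`exists_jointFamily_six_six`).  The cross-type space

  `V× = {row 0 = a ∈ K⁴, y₁₀ = p, y₂₀ = q, all other entries 0}`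
  `   = span {E₀₀, E₀₁, E₀₂, E₀₃, E₁₀, E₂₀} ⊆ row 0 ∪ column 0`

has all `3 × 3` subpermanents zero, dimension `6`, and for ALL `u ∈ K^{4×4}`, `y ∈ V×`:

  `per_4 (u + s y) = per_4 (u) + s e₁(u, y) + s² Σ_{k<6} c_k β_k(u, y)²`

with the six BILINEAR forms `β_k(u, y) = v_k ± n_k` (`k = 1, 2, 3`), where
`v_k = p u_{2k} + q u_{1k}` and `n_k = Σ_{l ≠ k} a_{m(k,l)} u_{3l}` (`{k, l, m(k,l)} = {1, 2, 3}`),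
and `c = (¼, ¼, ¼, −¼, −¼, −¼)`: indeed the `s²`-coefficient is
`p Σ_j a_j per u[{2,3}; {1,2,3}∖{j}] + q Σ_j a_j per u[{1,3}; {1,2,3}∖{j}] = Σ_k v_k n_k`.
(For generic `y ∈ V×` the Hessian `Hess per_4 (y)` has rank exactly `6`, so six squares are also
necessary; `V×` is killed at `d ≤ 5` by the first-minor lemma
`SymPencilPerFourHessianMinors.exists_perm_col_vanish_of_sum_sq_swap`, consistently with
`noJointFamily_six`.)

**Corollary** (`not_noJointFamily_six_six`).  `H106₆` — "no `6`-dimensional singular `V` carries a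
joint family of `6` squares" — is FALSE.  Consequence for the ladder: the `(10, 6, 6)` cell of the
size-`27` table (towards `28 ≤ sdc(per₄)`) needs input from the pencil beyond the singular subspace
`V = ker bL` and its joint family (e.g. base-point / kernel-invariance structure, as for the one-row
cells), exactly as `Cruxes/SdcPerBeyondN/NEXT-RUNG-H7.md` (H7.6) anticipated.

Honest framing: a calibration (negative knowledge); no lower bound changes (`27 ≤ sdc(per₄) ≤ 29`
stays), the crux `SdcSuperquadratic` and `VP ≠ VNP` are untouched.  No definitions, no named
facts. [folklore]
-/

noncomputable section

-- single-conjunct layout: Sub = Summit, duplicated namespace component intended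
set_option linter.dupNamespace false

namespace Summit.ValiantsHypothesis.ValiantsHypothesis.Theorems.SymPencilPerFourSixDimJointSix

open MvPolynomial Module
open Literature.Computability.AlgebraicComplexity
open Summit.ValiantsHypothesis.ValiantsHypothesis.Theorems.SymPencilBoxFourEquality

variable {K : Type*} [Field K]

/-- **A `6`-dimensional singular subspace of `per_4` with a joint family of six squares**: the
cross-type space `V× = span {E₀₀, E₀₁, E₀₂, E₀₃, E₁₀, E₂₀}`.  See the module docstring for the
explicit bilinear forms. [folklore] -/
theorem exists_jointFamily_six_six [CharZero K] :
    ∃ V : Submodule K (Fin 4 × Fin 4 → K),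
      (∀ x ∈ V, ∀ (r c : Fin 3 → Fin 4), Function.Injective r → Function.Injective c →
        ((Matrix.of fun i j => x (i, j)).submatrix r c).permanent = 0) ∧
      finrank K V = 6 ∧
      ∃ (c : Fin 6 → K) (β : Fin 6 → ((Fin 4 × Fin 4 → K) →ₗ[K] (Fin 4 × Fin 4 → K) →ₗ[K] K)),
        ∀ u : Fin 4 × Fin 4 → K, ∀ y ∈ V, ∃ e₀ e₁ : K, ∀ s : K,
          eval (u + s • y) (perPoly (Fin 4) K) = e₀ + s * e₁ + s ^ 2 * ∑ k, c k * (β k u y) ^ 2 := by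
  classical
  have hcases : ∀ i : Fin 4, i = 0 ∨ i = 1 ∨ i = 2 ∨ i = 3 := by decide
  -- the parametrisation `(a, p, q) ↦ (row 0 = a, y₁₀ = p, y₂₀ = q, 0 elsewhere)`
  let F : (Fin 4 → K) × K × K → (Fin 4 × Fin 4 → K) := fun g z =>
    if z.1 = 0 then g.1 z.2
    else if z.2 = 0 then (if z.1 = 1 then g.2.1 else if z.1 = 2 then g.2.2 else 0)
    else 0
  have hF : ∀ g z, F g z = (if z.1 = 0 then g.1 z.2
    else if z.2 = 0 then (if z.1 = 1 then g.2.1 else if z.1 = 2 then g.2.2 else 0)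
    else 0) := fun _ _ => rfl
  let ψ : ((Fin 4 → K) × K × K) →ₗ[K] (Fin 4 × Fin 4 → K) :=
    { toFun := F
      map_add' := fun g g' => by
        funext z; simp only [hF, Prod.fst_add, Prod.snd_add, Pi.add_apply]
        split_ifs <;> ring
      map_smul' := fun r g => by
        funext z; simp only [hF, Prod.smul_fst, Prod.smul_snd, Pi.smul_apply, smul_eq_mul,
          RingHom.id_apply]
        split_ifs <;> ring }
  have hψ : ∀ (a : Fin 4 → K) (p q : K) (i j : Fin 4), ψ (a, p, q) (i, j) =
      (if i = 0 then a j
        else if j = 0 then (if i = 1 then p else if i = 2 then q else 0) else 0) :=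
    fun _ _ _ _ _ => rfl
  -- entries
  have h0 : ∀ (a : Fin 4 → K) (p q : K) (j : Fin 4), ψ (a, p, q) (0, j) = a j :=
    fun a p q j => by rw [hψ]; simp
  have f10 : ((1 : Fin 4) = 0) = False := by decide
  have f20 : ((2 : Fin 4) = 0) = False := by decide
  have f21 : ((2 : Fin 4) = 1) = False := by decide
  have h10 : ∀ (a : Fin 4 → K) (p q : K), ψ (a, p, q) (1, 0) = p := fun a p q => by
    rw [hψ]; simp [f10]
  have h20 : ∀ (a : Fin 4 → K) (p q : K), ψ (a, p, q) (2, 0) = q := fun a p q => by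
    rw [hψ]; simp [f20, f21]
  have h1 : ∀ (a : Fin 4 → K) (p q : K) (j : Fin 4), j ≠ 0 → ψ (a, p, q) (1, j) = 0 :=
    fun a p q j hj => by rw [hψ]; simp [hj, f10]
  have h2 : ∀ (a : Fin 4 → K) (p q : K) (j : Fin 4), j ≠ 0 → ψ (a, p, q) (2, j) = 0 :=
    fun a p q j hj => by rw [hψ]; simp [hj, f20]
  have h3 : ∀ (a : Fin 4 → K) (p q : K) (j : Fin 4), ψ (a, p, q) (3, j) = 0 := fun a p q j => by
    rw [hψ]; simp [show ((3 : Fin 4) = 0) = False by decide, show ((3 : Fin 4) = 1) = False by decide,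
      show ((3 : Fin 4) = 2) = False by decide]
  have h11 : ∀ (a : Fin 4 → K) (p q : K), ψ (a, p, q) (1, 1) = 0 := fun a p q => h1 a p q 1 (by decide)
  have h12 : ∀ (a : Fin 4 → K) (p q : K), ψ (a, p, q) (1, 2) = 0 := fun a p q => h1 a p q 2 (by decide)
  have h13 : ∀ (a : Fin 4 → K) (p q : K), ψ (a, p, q) (1, 3) = 0 := fun a p q => h1 a p q 3 (by decide)
  have h21 : ∀ (a : Fin 4 → K) (p q : K), ψ (a, p, q) (2, 1) = 0 := fun a p q => h2 a p q 1 (by decide)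
  have h22 : ∀ (a : Fin 4 → K) (p q : K), ψ (a, p, q) (2, 2) = 0 := fun a p q => h2 a p q 2 (by decide)
  have h23 : ∀ (a : Fin 4 → K) (p q : K), ψ (a, p, q) (2, 3) = 0 := fun a p q => h2 a p q 3 (by decide)
  let W : Submodule K (Fin 4 × Fin 4 → K) := LinearMap.range ψ
  have hmem : ∀ x ∈ W, ∃ (a : Fin 4 → K) (p q : K), x = ψ (a, p, q) := by
    rintro _ ⟨⟨a, p, q⟩, rfl⟩
    exact ⟨a, p, q, rfl⟩
  -- `succAbove` on `Fin 4`
  have e00 : (0 : Fin 4).succAbove 0 = 1 := by decide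
  have e01 : (0 : Fin 4).succAbove 1 = 2 := by decide
  have e02 : (0 : Fin 4).succAbove 2 = 3 := by decide
  have e10 : (1 : Fin 4).succAbove 0 = 0 := by decide
  have e11 : (1 : Fin 4).succAbove 1 = 2 := by decide
  have e12 : (1 : Fin 4).succAbove 2 = 3 := by decide
  have e20 : (2 : Fin 4).succAbove 0 = 0 := by decide
  have e21 : (2 : Fin 4).succAbove 1 = 1 := by decide
  have e22 : (2 : Fin 4).succAbove 2 = 3 := by decide
  have e30 : (3 : Fin 4).succAbove 0 = 0 := by decide
  have e31 : (3 : Fin 4).succAbove 1 = 1 := by decide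
  have e32 : (3 : Fin 4).succAbove 2 = 2 := by decide
  -- the sixteen `3 × 3` subpermanents vanish (`V×` lies in the cross `row 0 ∪ column 0`)
  have hSing : ∀ x ∈ W, ∀ (r c : Fin 3 → Fin 4), Function.Injective r → Function.Injective c →
      ((Matrix.of fun i j => x (i, j)).submatrix r c).permanent = 0 := by
    intro x hx
    obtain ⟨a, p, q, rfl⟩ := hmem x hx
    refine subperm_vanish_inj_of_succAbove _ fun r c => ?_
    rcases hcases r with rfl | rfl | rfl | rfl <;> rcases hcases c with rfl | rfl | rfl | rfl <;>
      · simp only [Matrix.permanent_fin_three_row, Matrix.submatrix_apply, Matrix.of_apply,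
          e00, e01, e02, e10, e11, e12, e20, e21, e22, e30, e31, e32,
          h0, h10, h11, h12, h13, h20, h21, h22, h23, h3]
        ring
  -- dimension `6`
  have hinj : Function.Injective ψ := by
    refine (injective_iff_map_eq_zero ψ).2 fun g hg => ?_
    obtain ⟨a, p, q⟩ := g
    have ha : a = 0 := by
      funext j
      have h := congr_fun hg (0, j)
      rwa [h0] at h
    have hp : p = 0 := by have h := congr_fun hg (1, 0); rwa [h10] at h
    have hq : q = 0 := by have h := congr_fun hg (2, 0); rwa [h20] at h
    rw [ha, hp, hq]; rfl
  have hW6 : finrank K W = 6 := by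
    rw [LinearMap.finrank_range_of_inj hinj, Module.finrank_prod, Module.finrank_prod,
      finrank_fintype_fun_eq_card, Fintype.card_fin, Module.finrank_self]
  -- the bilinear monomials `u_P y_Q`
  let μ : (Fin 4 × Fin 4) → (Fin 4 × Fin 4) →
      ((Fin 4 × Fin 4 → K) →ₗ[K] (Fin 4 × Fin 4 → K) →ₗ[K] K) := fun P Q =>
    LinearMap.mk₂ K (fun u y => u P * y Q)
      (fun u₁ u₂ y => by simp only [Pi.add_apply]; ring)
      (fun r u y => by simp only [Pi.smul_apply, smul_eq_mul]; ring)
      (fun u y₁ y₂ => by simp only [Pi.add_apply]; ring)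
      (fun r u y => by simp only [Pi.smul_apply, smul_eq_mul]; ring)
  have hμ : ∀ P Q (u y : Fin 4 × Fin 4 → K), μ P Q u y = u P * y Q := fun _ _ _ _ => rfl
  -- `v_k = p u_{2k} + q u_{1k}`, `n_k = Σ_{l ≠ k} a_{m(k,l)} u_{3l}`; `β_k = v_k + n_k`, `β_{k+3} = v_k - n_k`
  let V₁ := μ (2, 1) (1, 0) + μ (1, 1) (2, 0)
  let V₂ := μ (2, 2) (1, 0) + μ (1, 2) (2, 0)
  let V₃ := μ (2, 3) (1, 0) + μ (1, 3) (2, 0)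
  let N₁ := μ (3, 2) (0, 3) + μ (3, 3) (0, 2)
  let N₂ := μ (3, 1) (0, 3) + μ (3, 3) (0, 1)
  let N₃ := μ (3, 1) (0, 2) + μ (3, 2) (0, 1)
  have hV₁ : ∀ u y : Fin 4 × Fin 4 → K, V₁ u y = u (2, 1) * y (1, 0) + u (1, 1) * y (2, 0) :=
    fun u y => by simp only [V₁, LinearMap.add_apply, hμ]
  have hV₂ : ∀ u y : Fin 4 × Fin 4 → K, V₂ u y = u (2, 2) * y (1, 0) + u (1, 2) * y (2, 0) :=
    fun u y => by simp only [V₂, LinearMap.add_apply, hμ]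
  have hV₃ : ∀ u y : Fin 4 × Fin 4 → K, V₃ u y = u (2, 3) * y (1, 0) + u (1, 3) * y (2, 0) :=
    fun u y => by simp only [V₃, LinearMap.add_apply, hμ]
  have hN₁ : ∀ u y : Fin 4 × Fin 4 → K, N₁ u y = u (3, 2) * y (0, 3) + u (3, 3) * y (0, 2) :=
    fun u y => by simp only [N₁, LinearMap.add_apply, hμ]
  have hN₂ : ∀ u y : Fin 4 × Fin 4 → K, N₂ u y = u (3, 1) * y (0, 3) + u (3, 3) * y (0, 1) :=
    fun u y => by simp only [N₂, LinearMap.add_apply, hμ]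
  have hN₃ : ∀ u y : Fin 4 × Fin 4 → K, N₃ u y = u (3, 1) * y (0, 2) + u (3, 2) * y (0, 1) :=
    fun u y => by simp only [N₃, LinearMap.add_apply, hμ]
  refine ⟨W, hSing, hW6, ![4⁻¹, 4⁻¹, 4⁻¹, -4⁻¹, -4⁻¹, -4⁻¹],
    ![V₁ + N₁, V₂ + N₂, V₃ + N₃, V₁ - N₁, V₂ - N₂, V₃ - N₃], fun u x hx => ?_⟩
  obtain ⟨a, p, q, rfl⟩ := hmem x hx
  refine ⟨(Matrix.of fun i j => u (i, j)).permanent,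
    ∑ j : Fin 4, a j * ((Matrix.of fun i j => u (i, j)).submatrix (0 : Fin 4).succAbove
        j.succAbove).permanent +
      p * ((Matrix.of fun i j => u (i, j)).submatrix (1 : Fin 4).succAbove
        (0 : Fin 4).succAbove).permanent +
      q * ((Matrix.of fun i j => u (i, j)).submatrix (2 : Fin 4).succAbove
        (0 : Fin 4).succAbove).permanent, fun s => ?_⟩
  rw [eval_perPoly, Matrix.permanent_fin_four_row, Matrix.permanent_fin_four_row, Fin.sum_univ_four]
  simp only [Fin.sum_univ_six, Matrix.cons_val_zero, Matrix.cons_val_one, Matrix.cons_val,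
    LinearMap.add_apply, LinearMap.sub_apply, hV₁, hV₂, hV₃, hN₁, hN₂, hN₃,
    Matrix.permanent_fin_three_row, Matrix.of_apply, Matrix.submatrix_apply, Pi.add_apply,
    Pi.smul_apply, smul_eq_mul, e00, e01, e02, e10, e11, e12, e20, e21, e22, e30, e31, e32,
    h0, h10, h11, h12, h13, h20, h21, h22, h23, h3]
  ring

/-- **`H106₆` is false**: it is NOT the case that every `6`-dimensional `V ⊆ Sing Z(per_4)`
carries no joint family of `6` squares (`exists_jointFamily_six_six`).  So the bound `d < 6` of
`SymPencilPerFourSixDimNoJointFamily.noJointFamily_six` is sharp, and the `(10, 6, 6)` cell of the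
size-`27` table needs input beyond the singular subspace and its joint family. [folklore] -/
theorem not_noJointFamily_six_six [CharZero K] :
    ¬ (∀ V : Submodule K (Fin 4 × Fin 4 → K),
      (∀ x ∈ V, ∀ (r c : Fin 3 → Fin 4), Function.Injective r → Function.Injective c →
        ((Matrix.of fun i j => x (i, j)).submatrix r c).permanent = 0) →
      finrank K V = 6 → ∀ (c : Fin 6 → K)
        (β : Fin 6 → ((Fin 4 × Fin 4 → K) →ₗ[K] (Fin 4 × Fin 4 → K) →ₗ[K] K)),
      ¬ (∀ u : Fin 4 × Fin 4 → K, ∀ y ∈ V, ∃ e₀ e₁ : K, ∀ s : K,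
          eval (u + s • y) (perPoly (Fin 4) K) =
            e₀ + s * e₁ + s ^ 2 * ∑ k, c k * (β k u y) ^ 2)) := by
  intro H
  obtain ⟨V, hV3, h6, c, β, hcβ⟩ := exists_jointFamily_six_six (K := K)
  exact H V hV3 h6 c β hcβ

end Summit.ValiantsHypothesis.ValiantsHypothesis.Theorems.SymPencilPerFourSixDimJointSix

end
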